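import Mathlib.Analysis.Calculus.ImplicitContDiff
import Mathlib.Analysis.Calculus.ContDiff.RCLike

/-!
# Route EIHFluxBalance — `CoerciveModulatedEnergy` (card K1): the abstract modulation lemma

Helper file for the (still informal, unsigned) support item stmt-FinalStateConjecture-10184
(`CoerciveModulatedEnergy`, card K1 of route `EIHFluxBalance`). Clause (iii) of that item asks that
"the minimiser `λ(g)` of the modulated energy `𝓔[g; λ]` of the deviation `h = g − G(λ)` exist and
be Lipschitz on `{𝓔 small}`". This file isolates the SOFT, model-independent content of that
clause, which is the Banach-space implicit function theorem applied to the modulation equations, in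
the two forms in which modulation parameters are fixed in practice:

* ORTHOGONALITY FORM (`exists_modulation`, `exists_modulation_lipschitz`): for a `Cⁿ` (`n ≥ 1`)
  family of reference states `G : P → V` (Banach space `V` of states, Banach space `P` of moduli)
  and a `Cⁿ` family of orthogonality functionals `T : P → (V →L[ℝ] W)`, IF the Gram operator
  `T(λ₀) ∘ DG(λ₀) : P →L[ℝ] W` is invertible THEN near `G(λ₀)` there is a `Cⁿ`, locally Lipschitz
  map `g ↦ λ(g)`, `λ(G λ₀) = λ₀`, with `T(λ(g))(g − G(λ(g))) = 0`, these equations having no other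
  solution near `(G λ₀, λ₀)`, and `Dλ(G λ₀) = (T(λ₀) ∘ DG(λ₀))⁻¹ ∘ T(λ₀)` (the classical formula
  `δλ = ⟨Z, ∂_λ G⟩⁻¹ ⟨Z, δg⟩`).
* CRITICAL-POINT FORM (`exists_criticalPoint_modulation`): for a `Cⁿ⁺¹` energy `𝓔 : V × P → ℝ`
  with `∂_λ𝓔(g₀, λ₀) = 0` whose partial Hessian `∂²_λ𝓔(g₀, λ₀) : P →L[ℝ] (P →L[ℝ] ℝ)` is
  invertible, the critical points of `λ ↦ 𝓔(g, λ)` near `λ₀` form a `Cⁿ`, locally Lipschitz graph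
  `λ = λ(g)` over a neighbourhood of `g₀`.

What this says for the item (recorded in the item memo): the Lipschitz modulation map of clause
(iii) is automatic ONCE the non-degeneracy holds; for the quadratic energy
`𝓔[g; λ] = B(λ)(g − G λ, g − G λ)` the `λ`-Hessian at `(G λ₀, λ₀)` is the symmetrisation of
`2·B(λ₀)(DG(λ₀)·, DG(λ₀)·)`, so (iii) needs `B(λ₀)` non-degenerate ON the moduli directions — a
condition that "coercivity modulo moduli" (clause (i)) does not supply and that a purely
gauge-invariant energy violates (Poincaré motions of a single hole are pure gauge).

Standard material: Weinstein, Comm. Pure Appl. Math. 39 (1986) 51–67, §2 (modulation of ground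
states); Stuart, J. Math. Pures Appl. 83 (2004) 541 (modulational approach); the implicit function
theorem is Mathlib's `ContDiffAt.implicitFunction`. [folklore]
No definitions are introduced: the modulation map is produced existentially.
-/

-- the doubled `FinalStateConjecture.FinalStateConjecture` path component trips dupNamespace
set_option linter.dupNamespace false

namespace Summit.FinalStateConjecture.FinalStateConjecture.Theorems

open Filter Topology Metric

noncomputable section

namespace Modulation

variable {V : Type*} [NormedAddCommGroup V] [NormedSpace ℝ V]
  {P : Type*} [NormedAddCommGroup P] [NormedSpace ℝ P]
  {W : Type*} [NormedAddCommGroup W] [NormedSpace ℝ W]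

/-- The derivative of the orthogonality map `F(g, λ) = T(λ)(g − G(λ))` at the base point
`(G λ₀, λ₀)`: since `g − G(λ)` vanishes there, only `T(λ₀) ∘ (δg − DG(λ₀) δλ)` survives.
Weinstein 1986, §2 (pattern). [folklore] -/
theorem hasFDerivAt_orthogonalityMap {n : WithTop ℕ∞} (hn : n ≠ 0)
    {G : P → V} {T : P → V →L[ℝ] W} {p₀ : P}
    (hG : ContDiffAt ℝ n G p₀) (hT : ContDiffAt ℝ n T p₀) :
    HasFDerivAt (fun q : V × P ↦ T q.2 (q.1 - G q.2))
      ((T p₀).comp (ContinuousLinearMap.fst ℝ V P -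
        (fderiv ℝ G p₀).comp (ContinuousLinearMap.snd ℝ V P))) (G p₀, p₀) := by
  have hT' : HasFDerivAt (fun q : V × P ↦ T q.2)
      ((fderiv ℝ T p₀).comp (ContinuousLinearMap.snd ℝ V P)) (G p₀, p₀) :=
    ((hT.differentiableAt hn).hasFDerivAt).comp (G p₀, p₀) hasFDerivAt_snd
  have hG' : HasFDerivAt (fun q : V × P ↦ G q.2)
      ((fderiv ℝ G p₀).comp (ContinuousLinearMap.snd ℝ V P)) (G p₀, p₀) :=
    ((hG.differentiableAt hn).hasFDerivAt).comp (G p₀, p₀) hasFDerivAt_snd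
  have h := hT'.clm_apply (hasFDerivAt_fst.sub hG')
  simpa using h

variable [CompleteSpace V] [CompleteSpace P] [CompleteSpace W]

/-- **Abstract modulation lemma, orthogonality form** (existence, smoothness, local uniqueness,
first-order formula). Let `G : P → V` be a `Cⁿ` (`n ≠ 0`) family of reference states in a real
Banach space `V` parametrised by a Banach space of moduli `P`, and `T : P → (V →L[ℝ] W)` a `Cⁿ`
family of orthogonality functionals such that the Gram operator `T(λ₀) ∘ DG(λ₀)` is invertible.
Then there is `λ : V → P`, `Cⁿ` at `G(λ₀)`, with `λ(G λ₀) = λ₀`, such that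
`T(λ(g))(g − G(λ(g))) = 0` for all `g` near `G(λ₀)`; near `(G λ₀, λ₀)` the modulation equations
`T(λ)(g − G(λ)) = 0` hold iff `λ = λ(g)`; and `Dλ(G λ₀) = (T(λ₀) ∘ DG(λ₀))⁻¹ ∘ T(λ₀)`.
Weinstein, CPAM 39 (1986), §2; Stuart, JMPA 83 (2004) (pattern); proof = implicit function
theorem. [folklore] -/
theorem exists_modulation {n : WithTop ℕ∞} (hn : n ≠ 0)
    {G : P → V} {T : P → V →L[ℝ] W} {p₀ : P}
    (hG : ContDiffAt ℝ n G p₀) (hT : ContDiffAt ℝ n T p₀)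
    (hnd : ((T p₀).comp (fderiv ℝ G p₀)).IsInvertible) :
    ∃ mod : V → P,
      mod (G p₀) = p₀ ∧
      ContDiffAt ℝ n mod (G p₀) ∧
      (∀ᶠ g in 𝓝 (G p₀), T (mod g) (g - G (mod g)) = 0) ∧
      (∀ᶠ q in 𝓝 (G p₀, p₀), T q.2 (q.1 - G q.2) = 0 ↔ mod q.1 = q.2) ∧
      HasStrictFDerivAt mod
        (((T p₀).comp (fderiv ℝ G p₀)).inverse.comp (T p₀)) (G p₀) := by
  set f : V × P → W := fun q ↦ T q.2 (q.1 - G q.2) with hf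
  have cdf : ContDiffAt ℝ n f (G p₀, p₀) := by
    have h2 : ContDiffAt ℝ n (fun q : V × P ↦ T q.2) (G p₀, p₀) :=
      hT.comp (G p₀, p₀) contDiffAt_snd
    have h3 : ContDiffAt ℝ n (fun q : V × P ↦ G q.2) (G p₀, p₀) :=
      hG.comp (G p₀, p₀) contDiffAt_snd
    exact h2.clm_apply (contDiffAt_fst.sub h3)
  have hfu : f (G p₀, p₀) = 0 := by simp [hf]
  have hderiv : fderiv ℝ f (G p₀, p₀) = (T p₀).comp (ContinuousLinearMap.fst ℝ V P -
      (fderiv ℝ G p₀).comp (ContinuousLinearMap.snd ℝ V P)) :=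
    (hasFDerivAt_orthogonalityMap hn hG hT).fderiv
  -- the partial derivative in the moduli direction is `-(T p₀ ∘ DG p₀)`
  have hinr : fderiv ℝ f (G p₀, p₀) ∘L ContinuousLinearMap.inr ℝ V P =
      ((ContinuousLinearEquiv.neg ℝ : W ≃L[ℝ] W) : W →L[ℝ] W) ∘L
        ((T p₀).comp (fderiv ℝ G p₀)) := by
    rw [hderiv]
    ext μ
    simp
  -- the partial derivative in the state direction is `T p₀`
  have hinl : fderiv ℝ f (G p₀, p₀) ∘L ContinuousLinearMap.inl ℝ V P = T p₀ := by
    rw [hderiv]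
    ext v
    simp
  have if₂ : (fderiv ℝ f (G p₀, p₀) ∘L ContinuousLinearMap.inr ℝ V P).IsInvertible := by
    rw [hinr]
    exact ContinuousLinearMap.isInvertible_equiv_comp.2 hnd
  refine ⟨cdf.implicitFunction hn if₂, cdf.implicitFunction_apply_self hn if₂,
    cdf.contDiffAt_implicitFunction hn if₂, ?_, ?_, ?_⟩
  · have h := cdf.eventually_apply_implicitFunction hn if₂
    rw [hfu] at h
    exact h
  · have h := cdf.eventually_apply_eq_iff_implicitFunction hn if₂
    rw [hfu] at h
    exact h
  · have h := cdf.hasStrictFDerivAt_implicitFunction hn if₂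
    rw [hinl, hinr, ContinuousLinearMap.inverse_equiv_comp] at h
    convert h using 1
    ext v
    simp

/-- **Abstract modulation lemma, orthogonality form, metric packaging** (clause (iii) of the item,
locally): under the hypotheses of `exists_modulation` with `n ≥ 1` there are a radius `ε > 0`, a
constant `K` and a map `λ : V → P` with `λ(G λ₀) = λ₀`, `K`-Lipschitz on the ball `B(G λ₀, ε)`,
solving the modulation equations `T(λ(g))(g − G(λ(g))) = 0` on that ball, and unique there: for
`g ∈ B(G λ₀, ε)` and `λ ∈ B(λ₀, ε)`, `T(λ)(g − G λ) = 0 → λ = λ(g)`. (`C¹ ⇒` locally Lipschitz: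
Mathlib `ContDiffAt.exists_lipschitzOnWith`.) Weinstein 1986, §2 (pattern). [folklore] -/
theorem exists_modulation_lipschitz {n : WithTop ℕ∞} (hn : 1 ≤ n)
    {G : P → V} {T : P → V →L[ℝ] W} {p₀ : P}
    (hG : ContDiffAt ℝ n G p₀) (hT : ContDiffAt ℝ n T p₀)
    (hnd : ((T p₀).comp (fderiv ℝ G p₀)).IsInvertible) :
    ∃ mod : V → P, ∃ ε > (0 : ℝ), ∃ K : NNReal,
      mod (G p₀) = p₀ ∧
      LipschitzOnWith K mod (ball (G p₀) ε) ∧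
      (∀ g ∈ ball (G p₀) ε, T (mod g) (g - G (mod g)) = 0) ∧
      (∀ g ∈ ball (G p₀) ε, ∀ p ∈ ball p₀ ε, T p (g - G p) = 0 → mod g = p) := by
  have hn0 : n ≠ 0 := by
    rintro rfl
    exact not_lt.2 hn zero_lt_one
  obtain ⟨mod, h0, hcd, hsol, huniq, -⟩ := exists_modulation hn0 hG hT hnd
  obtain ⟨K, t, ht, hK⟩ := (hcd.of_le hn).exists_lipschitzOnWith
  obtain ⟨ε₁, hε₁, hball₁⟩ := Metric.mem_nhds_iff.1 ht
  obtain ⟨ε₂, hε₂, hball₂⟩ := Metric.eventually_nhds_iff_ball.1 hsol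
  obtain ⟨ε₃, hε₃, hball₃⟩ := Metric.eventually_nhds_iff_ball.1 huniq
  refine ⟨mod, min ε₁ (min ε₂ ε₃), lt_min hε₁ (lt_min hε₂ hε₃), K, h0, ?_, ?_, ?_⟩
  · exact hK.mono ((ball_subset_ball (min_le_left _ _)).trans hball₁)
  · intro g hg
    exact hball₂ g (ball_subset_ball ((min_le_right _ _).trans (min_le_left _ _)) hg)
  · intro g hg p hp hTp
    have hg' : g ∈ ball (G p₀) ε₃ :=
      ball_subset_ball ((min_le_right _ _).trans (min_le_right _ _)) hg
    have hp' : p ∈ ball p₀ ε₃ :=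
      ball_subset_ball ((min_le_right _ _).trans (min_le_right _ _)) hp
    have hq : (g, p) ∈ ball (G p₀, p₀) ε₃ := by
      rw [← ball_prod_same]
      exact ⟨hg', hp'⟩
    exact (hball₃ (g, p) hq).1 hTp

omit [CompleteSpace W] in
/-- **Abstract modulation lemma, critical-point form.** Let `𝓔 : V × P → ℝ` be `Cⁿ⁺¹` (`n ≠ 0`)
at `(g₀, λ₀)` with `∂_λ𝓔(g₀, λ₀) = 0` and invertible partial Hessian
`∂_λ(∂_λ𝓔)(g₀, λ₀) : P →L[ℝ] (P →L[ℝ] ℝ)`. Then there is `λ : V → P`, `Cⁿ` at `g₀`, with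
`λ(g₀) = λ₀`, such that `λ(g)` is a critical point of `𝓔(g, ·)` for all `g` near `g₀`, and near
`(g₀, λ₀)` the critical points of `𝓔(g, ·)` are exactly `λ = λ(g)`. For the quadratic modulated
energy `𝓔[g; λ] = B(λ)(g − G λ, g − G λ)` at `g₀ = G λ₀` the first condition is automatic and the
partial Hessian is `μ ↦ (ν ↦ B(λ₀)(DG μ, DG ν) + B(λ₀)(DG ν, DG μ))`, so the hypothesis is
non-degeneracy of `B(λ₀)` on the moduli directions. Weinstein 1986, §2; Stuart 2004 (pattern);
proof = implicit function theorem for `∂_λ𝓔`. [folklore] -/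
theorem exists_criticalPoint_modulation {n : WithTop ℕ∞} (hn : n ≠ 0)
    {E : V × P → ℝ} {g₀ : V} {p₀ : P}
    (hE : ContDiffAt ℝ (n + 1) E (g₀, p₀))
    (hcrit : fderiv ℝ E (g₀, p₀) ∘L ContinuousLinearMap.inr ℝ V P = 0)
    (hHess : (fderiv ℝ (fun q ↦ fderiv ℝ E q ∘L ContinuousLinearMap.inr ℝ V P) (g₀, p₀) ∘L
        ContinuousLinearMap.inr ℝ V P).IsInvertible) :
    ∃ mod : V → P,
      mod g₀ = p₀ ∧
      ContDiffAt ℝ n mod g₀ ∧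
      (∀ᶠ g in 𝓝 g₀, fderiv ℝ E (g, mod g) ∘L ContinuousLinearMap.inr ℝ V P = 0) ∧
      (∀ᶠ q in 𝓝 (g₀, p₀),
        fderiv ℝ E q ∘L ContinuousLinearMap.inr ℝ V P = 0 ↔ mod q.1 = q.2) := by
  set f : V × P → (P →L[ℝ] ℝ) := fun q ↦ fderiv ℝ E q ∘L ContinuousLinearMap.inr ℝ V P with hf
  have cdf : ContDiffAt ℝ n f (g₀, p₀) :=
    (hE.fderiv_right (le_refl _)).clm_comp contDiffAt_const
  have hfu : f (g₀, p₀) = 0 := hcrit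
  refine ⟨cdf.implicitFunction hn hHess, cdf.implicitFunction_apply_self hn hHess,
    cdf.contDiffAt_implicitFunction hn hHess, ?_, ?_⟩
  · have h := cdf.eventually_apply_implicitFunction hn hHess
    rw [hfu] at h
    exact h
  · have h := cdf.eventually_apply_eq_iff_implicitFunction hn hHess
    rw [hfu] at h
    exact h

omit [CompleteSpace V] [CompleteSpace P] [CompleteSpace W] in
/-- For the QUADRATIC modulated energy `𝓔(g, λ) = B(λ)(g − G λ)(g − G λ)` the first hypothesis of
`exists_criticalPoint_modulation` is free: at a point of the modulated family, `g₀ = G(λ₀)`, the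
FULL derivative of `𝓔` vanishes (the energy is quadratic in the deviation `h = g − G λ`, which
vanishes there), in particular `∂_λ𝓔(G λ₀, λ₀) = 0`. Weinstein 1986, §2 (pattern). [folklore] -/
theorem hasFDerivAt_quadraticEnergy_base {n : WithTop ℕ∞} (hn : n ≠ 0)
    {B : P → V →L[ℝ] V →L[ℝ] ℝ} {G : P → V} {p₀ : P}
    (hB : ContDiffAt ℝ n B p₀) (hG : ContDiffAt ℝ n G p₀) :
    HasFDerivAt (fun q : V × P ↦ B q.2 (q.1 - G q.2) (q.1 - G q.2)) (0 : V × P →L[ℝ] ℝ)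
      (G p₀, p₀) := by
  have hG2 : ContDiffAt ℝ n (fun q : V × P ↦ G q.2) (G p₀, p₀) :=
    hG.comp (G p₀, p₀) contDiffAt_snd
  have hB2 : ContDiffAt ℝ n (fun q : V × P ↦ B q.2) (G p₀, p₀) :=
    hB.comp (G p₀, p₀) contDiffAt_snd
  have hu : HasFDerivAt (fun q : V × P ↦ q.1 - G q.2)
      (ContinuousLinearMap.fst ℝ V P - fderiv ℝ (fun q : V × P ↦ G q.2) (G p₀, p₀)) (G p₀, p₀) :=
    hasFDerivAt_fst.sub (hG2.differentiableAt hn).hasFDerivAt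
  have hc := (hB2.differentiableAt hn).hasFDerivAt.clm_apply hu
  have h := hc.clm_apply hu
  simp only [sub_self, map_zero, ContinuousLinearMap.zero_comp, add_zero] at h
  convert h using 1

omit [CompleteSpace V] [CompleteSpace P] in
/-- Unfolding lemma for the energy Gram operator of `exists_energyOrthogonal_modulation`:
`((compL.flip L) ∘ (B ∘ L)) μ ν = B (L μ) (L ν)`, i.e. it is the bilinear form `B` restricted to
the moduli directions `range L`, `L = DG(λ₀)`. [folklore] -/
theorem energyGram_apply (B₀ : V →L[ℝ] V →L[ℝ] ℝ) (L : P →L[ℝ] V) (μ ν : P) :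
    (((ContinuousLinearMap.compL ℝ P V ℝ).flip L).comp (B₀.comp L)) μ ν = B₀ (L μ) (L ν) := by
  simp

/-- **Energy-orthogonal modulation** (the linearised minimisation conditions of clause (iii)).
For the quadratic modulated energy `𝓔[g; λ] = B(λ)(g − G λ, g − G λ)` the critical-point equations
`∂_λ𝓔 = 0` read `2·B(λ)(h, DG(λ)μ) = (∂_μB)(λ)(h, h)` (`h = g − G λ`, `B` symmetric), whose part
LINEAR in `h` is the energy-orthogonality of `h` to the moduli directions:
`B(λ)(g − G λ, DG(λ)μ) = 0` for all `μ ∈ P`. If `B : P → (V →L V →L ℝ)` is `Cⁿ` and `G` is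
`Cⁿ⁺¹` at `λ₀` (`n ≠ 0`) and the energy Gram operator `μ ↦ B(λ₀)(DG(λ₀)μ, DG(λ₀)·) : P →L (P →L ℝ)`
is invertible — i.e. `B(λ₀)` is NON-DEGENERATE ON THE MODULI DIRECTIONS, a condition independent
of coercivity modulo moduli — then these conditions determine a `Cⁿ` (hence locally Lipschitz)
modulation map `λ(g)` near `G(λ₀)`, unique near `(G λ₀, λ₀)`. Instance of `exists_modulation`
with `T(λ) = (· ∘ DG(λ)) ∘ B(λ)`. Weinstein 1986, §2; Stuart 2004 (pattern). [folklore] -/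
theorem exists_energyOrthogonal_modulation {n : WithTop ℕ∞} (hn : n ≠ 0)
    {B : P → V →L[ℝ] V →L[ℝ] ℝ} {G : P → V} {p₀ : P}
    (hB : ContDiffAt ℝ n B p₀) (hG : ContDiffAt ℝ (n + 1) G p₀)
    (hnd : (((ContinuousLinearMap.compL ℝ P V ℝ).flip (fderiv ℝ G p₀)).comp
      ((B p₀).comp (fderiv ℝ G p₀))).IsInvertible) :
    ∃ mod : V → P,
      mod (G p₀) = p₀ ∧
      ContDiffAt ℝ n mod (G p₀) ∧
      (∀ᶠ g in 𝓝 (G p₀), ∀ μ, B (mod g) (g - G (mod g)) (fderiv ℝ G (mod g) μ) = 0) ∧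
      (∀ᶠ q in 𝓝 (G p₀, p₀),
        (∀ μ, B q.2 (q.1 - G q.2) (fderiv ℝ G q.2 μ) = 0) ↔ mod q.1 = q.2) := by
  set T : P → V →L[ℝ] (P →L[ℝ] ℝ) :=
    fun p ↦ ((ContinuousLinearMap.compL ℝ P V ℝ).flip (fderiv ℝ G p)).comp (B p) with hT
  have hTcd : ContDiffAt ℝ n T p₀ := by
    have hL : ContDiff ℝ n
        (fun L : P →L[ℝ] V ↦ (ContinuousLinearMap.compL ℝ P V ℝ).flip L) :=
      ContinuousLinearMap.contDiff (𝕜 := ℝ) (E := P →L[ℝ] V)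
        (F := (V →L[ℝ] ℝ) →L[ℝ] (P →L[ℝ] ℝ)) ((ContinuousLinearMap.compL ℝ P V ℝ).flip)
    have h1 : ContDiffAt ℝ n
        (fun p ↦ (ContinuousLinearMap.compL ℝ P V ℝ).flip (fderiv ℝ G p)) p₀ :=
      hL.contDiffAt.comp p₀ (hG.fderiv_right (le_refl _))
    exact h1.clm_comp hB
  have hTapply : ∀ (p : P) (h : V) (μ : P), T p h μ = B p h (fderiv ℝ G p μ) := by
    intro p h μ
    simp [hT]
  have hT0 : T p₀ ∘L fderiv ℝ G p₀ = ((ContinuousLinearMap.compL ℝ P V ℝ).flip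
      (fderiv ℝ G p₀)).comp ((B p₀).comp (fderiv ℝ G p₀)) := by
    rw [hT, ContinuousLinearMap.comp_assoc]
  have hnd' : (T p₀ ∘L fderiv ℝ G p₀).IsInvertible := by
    rw [hT0]
    exact hnd
  have hGn : ContDiffAt ℝ n G p₀ := hG.of_le le_self_add
  obtain ⟨mod, h0, hcd, hsol, huniq, -⟩ := exists_modulation hn hGn hTcd hnd'
  have hiff : ∀ (p : P) (h : V), T p h = 0 ↔ ∀ μ, B p h (fderiv ℝ G p μ) = 0 := by
    intro p h
    rw [ContinuousLinearMap.ext_iff]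
    simp only [hTapply, zero_apply]
  refine ⟨mod, h0, hcd, ?_, ?_⟩
  · filter_upwards [hsol] with g hg
    exact (hiff _ _).1 hg
  · filter_upwards [huniq] with q hq
    rw [← hq]
    exact (hiff _ _).symm

end Modulation

end

end Summit.FinalStateConjecture.FinalStateConjecture.Theorems
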